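/-
Copyright (c) 2026 the pub-hodgecm-mathlib formalisation cell (harness21).  Prover seat hodgecm-mathlib-K2Liu-p10 (g0), Track B «K2-LIT»,
#184♮ = hLiu418 = `stmt-HodgeConjecture-24832`; LEAD F0P6-plan (g11) RE-POINT 2026-09-04T05:28:07Z of req649 (S3) + GO 05:35:04Z: #33b (a), file (C),
PRELIMINARIES: the archimedean carriers `H_∞ = U(J^𝔻)(L ⊗ ℝ)`, their Gram matrices, the analytic inputs over `L ⊗ ℝ`, and the transport
`reindex e₂ : U(𝕁_∞ ⊕ −𝕁_∞) ≅ H_∞` (the heads (C1)–(C4) are in `K2LiuSiegelMainOrbitOpenEmbeddingArch`).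
-/
import Summits.HodgeConjecture.HodgeConjecture.Theorems.K2LiuSiegelMainOrbitOpenEmbeddingGeneric   -- ★ file (G): the generic chart (open embedding, range, closedness)
import Literature.NumberTheory.Automorphic.UnitaryGroupArchSiegelSquares                          -- ★ `reindex_fromBlocks_neg_map`, `isSiegelReindex_ofInfinite_iff`
import Literature.NumberTheory.GelbartRogawski1991.DoubledUnitarySiegelPlaceComponents             -- ★ `hermD`, `HA`, `IsSiegelDelta`, `IsSiegelM`
import Mathlib.Analysis.Normed.Ring.Units
import HarnessLib

/-!
# Crux `HLiu418`, road `K2_Liu`, socket #33b organ (a), file (C) — PRELIMINARIES for the ARCHIMEDEAN main-orbit open embedding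
# `P_{Δ,∞} × G_∞ ≅ Ω_∞ ⊆ H_∞ = U(J^𝔻)(L ⊗_ℚ ℝ)` (carriers, Gram matrices, analytic inputs, transport)

Cell `hodgecm-mathlib`, crux item hLiu418 = `stmt-HodgeConjecture-24832`; squad K2, LEAD F0P6-plan (g11) (ruling «M-155n», GO 2026-09-04T05:35:04Z), box K2E5-r01 (g6),
consumer K2E2-p12 (g3) (#33b (D-arch) + assembly), twin K2Liu-p08 (g0) (file (B), finite places).  THEOREMS ONLY (no `def`, no instance, no notation,
no named-fact hypothesis, no `sorry`); lane `--supports stmt-HodgeConjecture-24832 --as helper` (count-neutral helper).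

SETTING.  CM field `L`, `L⁺ = Fp L`, `c` = complex conjugation; the datum `e : Fin N × Fin M ≃ Fin n`, `dV`, `dW` of ★ `DoubledUnitaryGlobalSplittingData`;
`J^𝔻 = hermD L e dV hdV dW hdW ∈ M_{n+n}(L)`.  ARCHIMEDEAN CARRIERS (★ `UnitaryGroupArchimedean`): `R_∞ := L ⊗_ℚ ℝ = mixedSpace L` (a finite product of
copies of `ℝ` and `ℂ`), `σ_∞ := conjMixed L⁺ L c`, `H_∞ := UnitaryGroup.arch L⁺ L c (n + n) J^𝔻 = unitaryGroupOfForm σ_∞ (archFormOf L (n+n) J^𝔻) ≤ GL_{n+n}(R_∞)`.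
Write (spelled out everywhere, no definition) `𝕁_∞ := reindex e e (archFormOf L N (diag dV) ⊗ₖ archFormOf L M (diag dW)) ∈ M_n(R_∞)` — the archimedean
Gram matrix of `𝕎 = V ⊗ W` in the frame `e` —, `G_∞ := unitaryGroupOfForm σ_∞ 𝕁_∞ ≤ GL_n(R_∞)` (`= U(𝕎)(L⁺ ⊗ ℝ)`), `P_{Δ,∞} := {p : H_∞ // IsSiegelM ↑↑p}`
(★ `GRConstruction.IsSiegelM`: `p₁₁ + p₁₂ = p₂₁ + p₂₂` in the `e₂`-blocks), `M_∞(h) := (reindex e₂.symm e₂.symm ↑↑h)₂₂ − (…)₁₂`.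
NO archimedean doubling map is defined in the tree (★ `K2LiuDoublingZetaGL1Factor` §1); the embedding `x ↦ ι_∞(x, 1)` is therefore taken as ANY
homomorphism `j : G_∞ →* H_∞` PINNED BY ITS MATRIX `↑↑(j x) = reindex e₂ e₂ (fromBlocks ↑↑x 0 0 1)` (hypothesis `hj`, by value) — the literal twin
`(Subgroup.inclusion _).comp ((reindexU σ_∞ e₂ _).comp (blockDiag σ_∞ 𝕁_∞ (−𝕁_∞)))` of ★ `iotaGGLoc`'s body satisfies it (`coe_iotaArch`), and so will
any later `iotaGGArch` definition.

RESULTS.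
* §0 the two analytic inputs of file (G) for `R_∞` — `isOpen_setOf_isUnit_mixedSpace`, `continuousAt_inverse_mixedSpace` (Mathlib `Units.isOpen`,
  `NormedRing.inverse_continuousAt` for the complete normed ring `mixedSpace L`; elaborated AGAINST the product topology of the tree's carrier);
* §1 the archimedean Gram matrices: `pairFormArch_eq` (`𝕁_∞ = (gramR ⊗ 1) ⊗ 1`), `isUnit_det_pairFormArch`, **`archForm_hermD_eq`**
  (`archFormOf L (n+n) J^𝔻 = reindex e₂ e₂ (𝕁_∞ ⊕ −𝕁_∞)`, the twin of ★ `localForm_hermD_eq` ∕ `adelicForm_hermD_eq`);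
* §2 TRANSPORT along `reindexGL e₂ : U(𝕁_∞ ⊕ −𝕁_∞) ≅ H_∞`: membership both ways, the homeomorphism `exists_homeomorph_arch` (bijective, bicontinuous,
  multiplicative, matrices `reindex e₂ e₂` ∕ `reindex e₂⁻¹ e₂⁻¹`), `P_{Δ,∞}` closed (`isClosed_setOf_isSiegelM_arch`);
* §3 (C5) `isSiegelDelta_archToAdelic_iff` — `archToAdelic p ∈ P_Δ(𝔸) ↔ IsSiegelM ↑↑p` (the tree's two spellings of `P_Δ(L⁺ ⊗ ℝ)` agree);
  `coe_iotaArch` — the matrix of the literal twin of ★ `iotaGGLoc`'s body (discharges the pinning hypothesis `hj` of the heads); `reindex_reindex_symm_mul`.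
The HEADS (C1) open embedding, (C2) range `= Ω_∞`, (C3) `Ω_∞` open, (C4 = D1-arch) `P_{Δ,∞}·j(C)` closed are in the sequel `K2LiuSiegelMainOrbitOpenEmbeddingArch`.
[GelbartPiatetskishapiroRallis1987, Part A §1] [Liu2021, §B.3 (B.5), Lem. B.11] [HarrisKudlaSweet1996, §1 (1.9)–(1.12)] [BorelJacquet1979, §4.1].
HONEST LABEL.  Count-neutral helper; `HC_CM` is proved only modulo the 7 printed citations (2 remaining named inputs: hLiu418 = `stmt-HodgeConjecture-24832`,
h413 = `stmt-HodgeConjecture-24833`) until rung 0 closes.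
-/

set_option autoImplicit false
set_option linter.dupNamespace false -- the mandated namespace repeats `HodgeConjecture.HodgeConjecture`

noncomputable section

namespace Summit.HodgeConjecture.HodgeConjecture.Cruxes.HLiu418.K2LiuSiegelMainOrbitOpenEmbeddingArchPrelims

open Matrix Topology Set Filter
open scoped Pointwise Kronecker
open NumberField NumberField.mixedEmbedding IsDedekindDomain
open Literature.NumberTheory.Automorphic Literature.NumberTheory.Automorphic.UnitaryGroup
open Literature.NumberTheory.GelbartRogawski1991 Literature.NumberTheory.GelbartRogawski1991.GRConstruction
open Literature.NumberTheory.GelbartRogawski1991.UnitaryDualPair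
open Summit.HodgeConjecture.HodgeConjecture.Cruxes.HLiu418.K2LiuSiegelMainOrbitOpenEmbeddingGeneric

/-! ## §0 The analytic inputs over `L ⊗_ℚ ℝ` -/

section Inputs

variable (K : Type*) [Field K] [NumberField K]

open scoped Classical in
/-- **the units of `K ⊗_ℚ ℝ` form an OPEN set** (complete normed ring; Mathlib `Units.isOpen`, read in the product topology of `mixedSpace K`).
[cite: BorelJacquet1979, §4.1] -/
theorem isOpen_setOf_isUnit_mixedSpace : IsOpen {x : mixedSpace K | IsUnit x} := Units.isOpen

open scoped Classical in
/-- **`Ring.inverse` is CONTINUOUS at every unit of `K ⊗_ℚ ℝ`** (Mathlib `NormedRing.inverse_continuousAt`). [cite: BorelJacquet1979, §4.1] -/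
theorem continuousAt_inverse_mixedSpace (x : mixedSpace K) (hx : IsUnit x) : ContinuousAt Ring.inverse x := by
  obtain ⟨u, rfl⟩ := hx
  exact NormedRing.inverse_continuousAt u

end Inputs

/-! ## §1 The archimedean Gram matrices of `𝕎` and `𝔻 = 𝕎 ⊕ 𝕎⁻` -/

section Forms

variable (L : Type) [Field L] [NumberField L] [IsCMField L]
variable {N M n : ℕ} (e : Fin N × Fin M ≃ Fin n)
  (dV : Fin N → L) (hdV : ∀ i, IsCMField.complexConj L (dV i) = dV i)
  (dW : Fin M → L) (hdW : ∀ i, IsCMField.complexConj L (dW i) = dW i)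

/-- **`𝕁_∞ = (T ⊗_{L⁺} L) ⊗ 1`**: the archimedean pair form `reindex e e ((diag dV ⊗ 1) ⊗ₖ (diag dW ⊗ 1))` is the rational Gram matrix `gramR` pushed to `L ⊗ ℝ`.
[cite: HarrisKudlaSweet1996, §1 (1.9)] -/
theorem pairFormArch_eq :
    Matrix.reindex e e (archFormOf L N (Matrix.diagonal dV) ⊗ₖ archFormOf L M (Matrix.diagonal dW)) =
      ((gramR L e dV hdV dW hdW).map (algebraMap (Fp L) L)).map (mixedEmbedding L) := by
  show _ = ((Matrix.reindex e e (realDiagonal L dV hdV ⊗ₖ realDiagonal L dW hdW)).map _).map _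
  rw [UnitaryGroup.reindex_map, UnitaryGroup.reindex_map, ← UnitaryGroup.kronecker_map_map, realDiagonal_map, realDiagonal_map,
    ← UnitaryGroup.kronecker_map_map]
  rfl

include hdV hdW in
/-- `det 𝕁_∞` is a unit (all `dV i`, `dW j` non-zero). [cite: HarrisKudlaSweet1996, §1 (1.9)] -/
theorem isUnit_det_pairFormArch (hdV0 : ∀ i, dV i ≠ 0) (hdW0 : ∀ i, dW i ≠ 0) :
    IsUnit (Matrix.reindex e e (archFormOf L N (Matrix.diagonal dV) ⊗ₖ archFormOf L M (Matrix.diagonal dW))).det := by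
  rw [pairFormArch_eq L e dV hdV dW hdW, ← RingHom.mapMatrix_apply, ← RingHom.map_det, ← RingHom.mapMatrix_apply, ← RingHom.map_det]
  exact ((isUnit_det_gram (Fp L) e (isUnit_det_realDiagonal L dV hdV hdV0) (isUnit_det_realDiagonal L dW hdW hdW0)).map _).map _

/-- **the archimedean form matrix of `J^𝔻`** is the re-enumerated block form `𝕁_∞ ⊕ (−𝕁_∞)`:
`archFormOf L (n+n) J^𝔻 = reindex e₂ e₂ (fromBlocks 𝕁_∞ 0 0 (−𝕁_∞))` (twin of ★ `localForm_hermD_eq`). [cite: HarrisKudlaSweet1996, §1 (1.9)] -/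
theorem archForm_hermD_eq :
    archFormOf L (n + n) (hermD L e dV hdV dW hdW) =
      Matrix.reindex (e₂ (n := n)) (e₂ (n := n))
        (fromBlocks (Matrix.reindex e e (archFormOf L N (Matrix.diagonal dV) ⊗ₖ archFormOf L M (Matrix.diagonal dW))) 0 0
          (-Matrix.reindex e e (archFormOf L N (Matrix.diagonal dV) ⊗ₖ archFormOf L M (Matrix.diagonal dW)))) := by
  rw [pairFormArch_eq L e dV hdV dW hdW]
  unfold archFormOf hermD gramD
  rw [reindex_fromBlocks_neg_map, reindex_fromBlocks_neg_map]

end Forms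


/-! ## §2 Transport along `reindexGL e₂ : U(𝕁_∞ ⊕ −𝕁_∞) ≅ H_∞` -/

section Transport

variable (L : Type) [Field L] [NumberField L] [IsCMField L]
variable {N M n : ℕ} (e : Fin N × Fin M ≃ Fin n)
  (dV : Fin N → L) (hdV : ∀ i, IsCMField.complexConj L (dV i) = dV i)
  (dW : Fin M → L) (hdW : ∀ i, IsCMField.complexConj L (dW i) = dW i)

/-- `reindex e₂ e₂ g ∈ H_∞ ↔ g ∈ U(𝕁_∞ ⊕ −𝕁_∞)` (★ `reindexGL_mem_iff` along `archForm_hermD_eq`). [cite: HarrisKudlaSweet1996, §1 (1.9)] -/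
theorem reindexGL_mem_arch_iff (g : GL (Fin n ⊕ Fin n) (mixedSpace L)) :
    reindexGL (e₂ (n := n)) g ∈ arch (Fp L) L (IsCMField.complexConj L) (n + n) (hermD L e dV hdV dW hdW) ↔
      g ∈ unitaryGroupOfForm (conjMixed (Fp L) L (IsCMField.complexConj L))
        (fromBlocks (Matrix.reindex e e (archFormOf L N (Matrix.diagonal dV) ⊗ₖ archFormOf L M (Matrix.diagonal dW))) 0 0
          (-Matrix.reindex e e (archFormOf L N (Matrix.diagonal dV) ⊗ₖ archFormOf L M (Matrix.diagonal dW)))) := by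
  rw [arch, archForm_hermD_eq L e dV hdV dW hdW]
  exact reindexGL_mem_iff _ _ _ g

omit [NumberField L] [IsCMField L] in
/-- `reindex e₂ e₂ (reindex e₂⁻¹ e₂⁻¹ h) = h` in `GL`. [folklore] -/
theorem reindexGL_reindexGL_symm (h : GL (Fin (n + n)) (mixedSpace L)) :
    reindexGL (e₂ (n := n)) (reindexGL (e₂ (n := n)).symm h) = h :=
  Units.ext (by rw [coe_reindexGL, coe_reindexGL, ← Matrix.reindex_symm, Equiv.apply_symm_apply])

omit [NumberField L] [IsCMField L] in
/-- `reindex e₂⁻¹ e₂⁻¹ (reindex e₂ e₂ g) = g` in `GL`. [folklore] -/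
theorem reindexGL_symm_reindexGL (g : GL (Fin n ⊕ Fin n) (mixedSpace L)) :
    reindexGL (e₂ (n := n)).symm (reindexGL (e₂ (n := n)) g) = g :=
  Units.ext (by rw [coe_reindexGL, coe_reindexGL, ← Matrix.reindex_symm, Equiv.symm_apply_apply])

/-- `reindex e₂⁻¹ e₂⁻¹ h ∈ U(𝕁_∞ ⊕ −𝕁_∞) ↔ h ∈ H_∞`. [cite: HarrisKudlaSweet1996, §1 (1.9)] -/
theorem reindexGL_symm_mem_iff (h : GL (Fin (n + n)) (mixedSpace L)) :
    reindexGL (e₂ (n := n)).symm h ∈ unitaryGroupOfForm (conjMixed (Fp L) L (IsCMField.complexConj L))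
        (fromBlocks (Matrix.reindex e e (archFormOf L N (Matrix.diagonal dV) ⊗ₖ archFormOf L M (Matrix.diagonal dW))) 0 0
          (-Matrix.reindex e e (archFormOf L N (Matrix.diagonal dV) ⊗ₖ archFormOf L M (Matrix.diagonal dW)))) ↔
      h ∈ arch (Fp L) L (IsCMField.complexConj L) (n + n) (hermD L e dV hdV dW hdW) := by
  rw [← reindexGL_mem_arch_iff L e dV hdV dW hdW, reindexGL_reindexGL_symm]

/-- **`H_∞ ≅ U(𝕁_∞ ⊕ −𝕁_∞)` as topological spaces**: a homeomorphism whose underlying maps are `reindex e₂ e₂` and `reindex e₂⁻¹ e₂⁻¹` on matrices.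
[cite: HarrisKudlaSweet1996, §1 (1.9)] [cite: BorelJacquet1979, §4.1] -/
theorem exists_homeomorph_arch :
    ∃ eH : unitaryGroupOfForm (conjMixed (Fp L) L (IsCMField.complexConj L))
        (fromBlocks (Matrix.reindex e e (archFormOf L N (Matrix.diagonal dV) ⊗ₖ archFormOf L M (Matrix.diagonal dW))) 0 0
          (-Matrix.reindex e e (archFormOf L N (Matrix.diagonal dV) ⊗ₖ archFormOf L M (Matrix.diagonal dW)))) ≃ₜ
        arch (Fp L) L (IsCMField.complexConj L) (n + n) (hermD L e dV hdV dW hdW),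
      (∀ g, ((eH g : arch (Fp L) L (IsCMField.complexConj L) (n + n) (hermD L e dV hdV dW hdW)) : GL (Fin (n + n)) (mixedSpace L)) =
          reindexGL (e₂ (n := n)) (g : GL (Fin n ⊕ Fin n) (mixedSpace L))) ∧
      (∀ h, ((eH.symm h : unitaryGroupOfForm (conjMixed (Fp L) L (IsCMField.complexConj L))
          (fromBlocks (Matrix.reindex e e (archFormOf L N (Matrix.diagonal dV) ⊗ₖ archFormOf L M (Matrix.diagonal dW))) 0 0
            (-Matrix.reindex e e (archFormOf L N (Matrix.diagonal dV) ⊗ₖ archFormOf L M (Matrix.diagonal dW))))) :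
            GL (Fin n ⊕ Fin n) (mixedSpace L)) = reindexGL (e₂ (n := n)).symm (h : GL (Fin (n + n)) (mixedSpace L))) ∧
      (∀ g g', eH (g * g') = eH g * eH g') :=
  ⟨{ toFun := fun g => ⟨reindexGL (e₂ (n := n)) (g : GL (Fin n ⊕ Fin n) (mixedSpace L)), (reindexGL_mem_arch_iff L e dV hdV dW hdW _).2 g.2⟩
     invFun := fun h => ⟨reindexGL (e₂ (n := n)).symm (h : GL (Fin (n + n)) (mixedSpace L)), (reindexGL_symm_mem_iff L e dV hdV dW hdW _).2 h.2⟩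
     left_inv := fun g => by
       apply Subtype.ext
       exact reindexGL_symm_reindexGL L (g : GL (Fin n ⊕ Fin n) (mixedSpace L))
     right_inv := fun h => by
       apply Subtype.ext
       exact reindexGL_reindexGL_symm L (h : GL (Fin (n + n)) (mixedSpace L))
     continuous_toFun := ((continuous_reindexGL _).comp continuous_subtype_val).subtype_mk _
     continuous_invFun := ((continuous_reindexGL _).comp continuous_subtype_val).subtype_mk _ },
    fun _ => rfl, fun _ => rfl, fun g g' => Subtype.ext (map_mul (reindexGL (e₂ (n := n))) _ _)⟩

omit [NumberField L] [IsCMField L] in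
/-- `X ↦ reindex e₂⁻¹ e₂⁻¹ X` is continuous on matrices. [folklore] -/
theorem continuous_reindex_symm : Continuous fun X : Matrix (Fin (n + n)) (Fin (n + n)) (mixedSpace L) =>
    Matrix.reindex (e₂ (n := n)).symm (e₂ (n := n)).symm X :=
  continuous_id.matrix_submatrix _ _

/-- **`P_{Δ,∞} = {p : H_∞ | IsSiegelM ↑↑p}` is CLOSED in `H_∞`.** [cite: GelbartPiatetskishapiroRallis1987, Part A §1] -/
theorem isClosed_setOf_isSiegelM_arch :
    IsClosed {p : arch (Fp L) L (IsCMField.complexConj L) (n + n) (hermD L e dV hdV dW hdW) |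
      IsSiegelM ((p : GL (Fin (n + n)) (mixedSpace L)) : Matrix (Fin (n + n)) (Fin (n + n)) (mixedSpace L))} := by
  have hcoe : Continuous fun p : arch (Fp L) L (IsCMField.complexConj L) (n + n) (hermD L e dV hdV dW hdW) =>
      Matrix.reindex (e₂ (n := n)).symm (e₂ (n := n)).symm ((p : GL (Fin (n + n)) (mixedSpace L)) : Matrix (Fin (n + n)) (Fin (n + n)) (mixedSpace L)) :=
    (continuous_reindex_symm L).comp (Units.continuous_val.comp continuous_subtype_val)
  exact isClosed_eq ((continuous_toBlocks.1.comp hcoe).add (continuous_toBlocks.2.1.comp hcoe))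
    ((continuous_toBlocks.2.2.1.comp hcoe).add (continuous_toBlocks.2.2.2.comp hcoe))

end Transport

/-! ## §3 The two spellings of `P_Δ(L⁺ ⊗ ℝ)`; the matrix of the literal `ι_∞` -/

section Heads

variable (L : Type) [Field L] [NumberField L] [IsCMField L]
variable {N M n : ℕ} (e : Fin N × Fin M ≃ Fin n)
  (dV : Fin N → L) (hdV : ∀ i, IsCMField.complexConj L (dV i) = dV i)
  (dW : Fin M → L) (hdW : ∀ i, IsCMField.complexConj L (dW i) = dW i)

/-- **(C5) the two spellings of `P_Δ(L⁺ ⊗ ℝ)` agree**: `archToAdelic p ∈ P_Δ(𝔸)` (★ `IsSiegelDelta`) iff `IsSiegelM ↑↑p` (★ `isSiegelReindex_ofInfinite_iff`: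
the finite component `1` is Siegel). [cite: BorelJacquet1979, §4.1] [cite: GelbartPiatetskishapiroRallis1987, Part A §1] -/
theorem isSiegelDelta_archToAdelic_iff (p : arch (Fp L) L (IsCMField.complexConj L) (n + n) (hermD L e dV hdV dW hdW)) :
    IsSiegelDelta L e dV hdV dW hdW (archToAdelic (Fp L) L (IsCMField.complexConj L) (n + n) (hermD L e dV hdV dW hdW) p) ↔
      IsSiegelM ((p : GL (Fin (n + n)) (mixedSpace L)) : Matrix (Fin (n + n)) (Fin (n + n)) (mixedSpace L)) :=
  isSiegelReindex_ofInfinite_iff L (n + n) (e₂ (n := n)) (p : GL (Fin (n + n)) (mixedSpace L))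

/-- the matrix of the literal archimedean twin `(inclusion ∘ reindexU e₂ ∘ blockDiag)(x, y)` of ★ `iotaGGLoc`'s body is `reindex e₂ e₂ (fromBlocks x 0 0 y)`;
in particular it satisfies the pinning hypothesis `hj` of (C1)–(C4) at `y = 1`. [cite: HarrisKudlaSweet1996, §1 (1.11)] -/
theorem coe_iotaArch (x : unitaryGroupOfForm (conjMixed (Fp L) L (IsCMField.complexConj L))
      (Matrix.reindex e e (archFormOf L N (Matrix.diagonal dV) ⊗ₖ archFormOf L M (Matrix.diagonal dW))))
    (y : unitaryGroupOfForm (conjMixed (Fp L) L (IsCMField.complexConj L))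
      (-Matrix.reindex e e (archFormOf L N (Matrix.diagonal dV) ⊗ₖ archFormOf L M (Matrix.diagonal dW)))) :
    (((((Subgroup.inclusion (le_of_eq (congrArg (unitaryGroupOfForm (conjMixed (Fp L) L (IsCMField.complexConj L)))
          (archForm_hermD_eq L e dV hdV dW hdW).symm))).comp
        ((reindexU (conjMixed (Fp L) L (IsCMField.complexConj L)) (e₂ (n := n)) _).comp
          (blockDiag (conjMixed (Fp L) L (IsCMField.complexConj L))
            (Matrix.reindex e e (archFormOf L N (Matrix.diagonal dV) ⊗ₖ archFormOf L M (Matrix.diagonal dW)))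
            (-Matrix.reindex e e (archFormOf L N (Matrix.diagonal dV) ⊗ₖ archFormOf L M (Matrix.diagonal dW))))))
        (x, y) : arch (Fp L) L (IsCMField.complexConj L) (n + n) (hermD L e dV hdV dW hdW)) : GL (Fin (n + n)) (mixedSpace L)) :
        Matrix (Fin (n + n)) (Fin (n + n)) (mixedSpace L)) =
      Matrix.reindex (e₂ (n := n)) (e₂ (n := n))
        (fromBlocks ((x : GL (Fin n) (mixedSpace L)) : Matrix (Fin n) (Fin n) (mixedSpace L)) 0 0
          ((y : GL (Fin n) (mixedSpace L)) : Matrix (Fin n) (Fin n) (mixedSpace L))) :=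
  rfl

omit [NumberField L] [IsCMField L] in
/-- the matrix identity behind the transport: `reindex e₂ e₂ (reindex e₂⁻¹ e₂⁻¹ A · B) = A · reindex e₂ e₂ B`. [folklore] -/
theorem reindex_reindex_symm_mul (A : Matrix (Fin (n + n)) (Fin (n + n)) (mixedSpace L)) (B : Matrix (Fin n ⊕ Fin n) (Fin n ⊕ Fin n) (mixedSpace L)) :
    Matrix.reindex (e₂ (n := n)) (e₂ (n := n)) (Matrix.reindex (e₂ (n := n)).symm (e₂ (n := n)).symm A * B) =
      A * Matrix.reindex (e₂ (n := n)) (e₂ (n := n)) B := by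
  simp only [Matrix.reindex_apply, Equiv.symm_symm]
  rw [Matrix.submatrix_mul _ _ _ (e₂ (n := n)).symm _ (e₂ (n := n)).symm.bijective, Matrix.submatrix_submatrix, Equiv.self_comp_symm,
    Matrix.submatrix_id_id]

end Heads

end Summit.HodgeConjecture.HodgeConjecture.Cruxes.HLiu418.K2LiuSiegelMainOrbitOpenEmbeddingArchPrelims
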